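import Mathlib
import HarnessLib
import HarnessLib.Audit
import Summits.AtomisticToContinuum.Statement
import Literature.Analysis.FluidPDE.HardSphereTimeScaling
import Summits.AtomisticToContinuum.HydrodynamicLimit.Theorems.RelayRaceLocalityRestartPrincipleStubMeanClosure
import HarnessLib.Audit.Status.Attr

/-!
Route: AthermalClockWard

DORMANT since 2026-08-23T09:35:16Z (reconciler: no traction for 6 d (last activity statement-grounded at 2026-08-17T07:59:05Z); parked, not closed — `ledger route dormant route-AtomisticToContinuum-AthermalClockWard --off` to reactivate) — unstaffed, not closed; items shared with open routes are served there. `ledger route dormant <id> --off` reactivates.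

# Route AthermalClockWard — heating is fast-forward — the athermal Ward identity makes d/dt of the
mean fields one score covariance; the two mean flux closures in that one direction +
entropy-saturated mean closure decide the conjunct

X = X_R ∧ X_M with X_R = X_Rm ∧ X_Re ("it suffices to show"), the conforming (D-0027 §2.1) successor
of the retired route AthermalWard, realising card
athermal-clock-ward-identity (spine; uses (1)–(2)) with the mean-closure step of card
entropy-saturation-mean-closure. Hard spheres are
athermal: `scaleVel c` conjugates Φ_t to Φ_{ct} (tree theorem `IsHardSphereTrajectory.timeDilate`)
and pushes localGibbsLaw(a,u,θ) to
localGibbsLaw(a,cu,c²θ), so at every finite N the mean fields V(t) = E_{LG}[U_N(Φ_t z)] obey the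
WARD IDENTITY t∂_tV + D′V = Cov_{LG}(U_N(Φ_t z), K),
D′ = diag(0,1,2), K = Σ_i[(|v_i|² − v_i·u₀(x_i))/θ₀(x_i) − 3] the initial energy score (supports
ScalingCovariance, WardIdentity). X_R
(OneDirectionResponse, now a derived support): in the dilute band that ONE covariance converges,
uniformly on [0,t], to (s∂_s + D′)U^E — a single
direction of nonequilibrium linear response, which the identity integrates in time to the MEAN limit
(target MeanHydroLimitInBand, via the typed glue
WardToMeans). By WardIdentity its two clauses ARE the two constitutive closures of Euler
hydrodynamics IN MEAN (Spohn1991 §3.2 (3.14)–(3.17); the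
mass flux closes exactly, support MeanMassContinuity): X_Re (EnergyFluxResponse, crux 2) — the mean
ENERGY current → (E + p)u, cubic velocity
moment / heat current; X_Rm (MomentumFluxResponse, crux 3) — the mean MOMENTUM current → ρu⊗u + p𝟙,
second moments + collisional virial.
X_M (MeanClosure, crux 4): means ⇒ probability, because Liouville pins the Shannon entropy and log
of a local Gibbs density is linear in the
fields. STATEMENT RETYPE 2026-08-16 (p126922, D-0032): the conjunct `_root_.HydrodynamicLimit` is
now the PACKING-GUARDED limit (∃ η₀ outermost;
solutions with ρ_t(x)σ³ < η₀ on [0,T); verbatim `HydroLimitInBandDim 3`), which is exactly the band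
in which X_R and X_M are stated — so the
former conjunct X_D (DiluteSelfConsistency, shared item 3091: admissible solutions stay dilute) is
no longer needed and is dropped from this
route; MeanClosure lifts means to probability. CRUX-ONLY REPAIR 2026-08-16 (human ruling: only crux
items may be hypotheses of
`closes`): the three finite-N Ward supports W = WardIdentity, C = MeanMassContinuity, S =
LocalGibbsStatics and the typed analytic glue
WardToMeans — all provable now — are folded into ONE provable crux ResponseToMeans :=
MomentumFluxResponse → EnergyFluxResponse → MeanHydroLimitInBand (rank 5;
stated over the two flux cruxes, whose conjunction at a common threshold is OneDirectionResponse; =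
fun hRm hRe => WardToMeans (odr hRm hRe) W C S,
Sketch.lean), MeanClosure is re-kinded crux (rank 4), and the deciding theorem `closes` (sorry-free,
pure logic) takes the FOUR cruxes Rm, Re, ResponseToMeans, M to `_root_.HydrodynamicLimit` with η₀
:= min(η_R, η_M), η_R := min(η_Rm, η_Re).
Lean: `MomentumFluxResponse ∧ EnergyFluxResponse ∧ ResponseToMeans ∧ MeanClosure`

## Assembly
Pure logic over the four cruxes, sorry-free in Sketch.lean / glue.lean (lean check rc 0, axioms
propext / Classical.choice / Quot.sound):
X_mean := ResponseToMeans Rm Re with its η₁ (inside any proof of ResponseToMeans, R := Rm ∧ Re =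
OneDirectionResponse at η_R := min(η_Rm, η_Re),
σ := min — `oneDirectionResponse_of_flux`, Sketch.lean); η₂ from MeanClosure; η₀ := min(η₁, η₂)
instantiates the Statement's outermost ∃ η₀. Given profiles take σ₁, σ₂ from X_mean and MeanClosure;
σ₀ := min(σ₁, σ₂). For σ < σ₀, a classical solution on [0,T) with packing ρ_t(x)σ³ < η₀ (the
Statement's guard, hence < η₁ and < η₂), flows Φ,
the t = 0 LLN and t ∈ [0,T): X_mean gives the means at t for every smooth χ, MeanClosure turns them
into TendstoHydroFieldsAt at t — verbatim the
body of `_root_.HydrodynamicLimit` (= HydroLimitInBandDim 3, `hydroLimitInBandDim_three_iff_root`).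
ScalingCovariance feeds WardIdentity; WardIdentity, MeanMassContinuity, LocalGibbsStatics and
WardToMeans compose to ResponseToMeans in one line
(`responseToMeans_of_supports`, Sketch.lean) and stay filed as provable-now supports, so the old
seven-hypothesis theorem is recovered and nothing
was weakened; ClockIdentity is the negative-side / MD handle; none of these is a hypothesis of
`closes`.

Rationale: WHY THIS LINE. The mechanism is an exact symmetry nobody cashed on the nonequilibrium problem: for
hard spheres temperature is time, so the c-derivative of
the exponential family localGibbsLaw(a,cu,c²θ) — a covariance with the explicit score K — equals
(t∂_t + D′) of the mean fields in closed
form (velocity-dilation generator conjugate to temperature about HOMOGENEOUS states: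
DuftyBaskaranBrey2008 §7, BaskaranDuftyJavierbrey2007;
tilt-derivative form of EQUILIBRIUM time correlations: Spohn1991 §7.1 (7.16); ensemble shadow:
LebowitzPercusVerlet1967; likelihood-ratio
sensitivity: Glynn1990). It collapses the dynamical closure input to ONE direction of
conditional-mean response integrated in TIME from the
t = 0 law of large numbers (its momentum and energy components — by the identity the classical
stress and energy-current closures IN MEAN, Spohn1991 (3.16)–(3.17) — are the route's two cruxes
since the 2026-08-16 repair), where the retired OneParticleInfluence needed every score direction
along a homotopy of PROFILES plus a variance
leg, and entropy routes (UGibbsSRBRigidity, HeatBathForgetting) need H_N(t) = o(N) from a dynamical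
mixing input; here means suffice because the
entropy budget is saturated (Yau1991, OllaVaradhanYau1993 Thm 1.1, KipnisLandim1999 Ch. 6; statics
Ruelle1969, LebowitzPenrose1964,
Georgii1994), so no variance / two-marginal statement is filed. Imported areas: Ward identities of a
scaling symmetry (field theory) and
score-function sensitivity (statistics); relative-entropy bookkeeping (stochastic hydrodynamic
limits); ballistic fluctuation theory only as the
consumer of the exact clock mode (DoyonEtAl2023, DoyonEtAl2023PRL). What is new relative to the
retired predecessor: the supports now rest on
PROVED cone theorems (timeDilate, flow_eq_ae_holds, isProbabilityMeasure_localGibbsLaw, the Gaussian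
disintegration of HardSphereEulerProofs),
the analytic assembly is itself typed (support WardToMeans; since the crux-only repair of 2026-08-16
its composite with the three finite-N
identities, ResponseToMeans, is the crux `closes` consumes), and `closes` reaches the Statement decl
from cruxes only.

RANKED CRUXES. #0 MeanHydroLimitInBand (target) — MEAN hydrodynamic limit in the dilute band (typed
waypoint X_mean): ∃ η > 0, ∀ continuous positive profiles ∃ σ₀ ∀ σ ∈ (0,σ₀), for every classical
hs-Euler solution on [0,T) with packing ρ_t(x)σ³ < η on [0,T), every flow family with the t = 0 LLN,
every t < T and every smooth χ, the EXPECTATIONS under localGibbsLaw of the empirical density /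
momentum (componentwise) / energy fields at time t converge to ∫χρ_t, ∫χρ_t u_{t,j}, ∫χE_t.
Delivered by ResponseToMeans from Rm, Re (= WardToMeans from R = Rm ∧ Re, W, C, S); MeanClosure
lifts it to the packing-guarded conjunct inside `closes` (the Statement's guard ρ_t(x)σ³ < η₀, η₀ :=
min(η_R, η_M), supplies the band). (why it might fail: it is the packing-guarded conjunct restricted
to means (equivalent to it by entropy saturation): fails iff local equilibrium fails to propagate IN
MEAN at fixed small σ before the shock (Spohn1991 I.3.1).) [Spohn1991, OllaVaradhanYau1993]
#2 EnergyFluxResponse (crux) — MEAN ENERGY-CURRENT CLOSURE IN THE ONE DIRECTION (the energy clause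
of OneDirectionResponse as its own item, same prefix and packing guard): ∃ η > 0, ∀ continuous
positive profiles ∃ σ₀ ∀ σ ∈ (0,σ₀) ∀ classical hs-Euler solutions on [0,T) with packing < η, ∀ flow
families with the t = 0 LLN, ∀ t < T, ∀ smooth χ: Cov_{LG_N}(K_N, ⟨e_N(Φ_{N,s}z),χ⟩) → s∂_s∫χE_s +
2∫χE_s UNIFORMLY in s ∈ [0,t]. By WardIdentity (energy clause) the left side is
s⁻¹∂_s(s²E⟨e_N(s),χ⟩), so this is convergence of the MEAN ENERGY CURRENT E⟨j₄(s),∇χ⟩ to the Euler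
value ∫∇χ·(E_s + p_s)u_s (Spohn1991 §3.2 (3.8), (3.14), (3.17)): the kinetic part needs the CUBIC
conditional velocity moment of f_s to be locally Maxwellian in mean (heat current q = 0 at Euler
order), the collisional part the mean collisional energy transfer. Ranked hardest: the one place
where high velocities enter the route (HighMomentumCutoffBarrier); only the conserved total energy
as a priori control. [difficulty: open-problem] (why it might fail: no |v|³ uniform integrability
along deterministic hard-sphere flow at fixed σ is known; a heat current surviving IN MEAN over
≍N^{1/3} collision times, or kinetic-frequency oscillation of the mean energy flux (uniformity in
s), makes it false while the mean energy FIELD could still converge.) [Spohn1991,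
BodineauGallagherSaintRaymondSimonella2023, OllaVaradhanYau1993, DuftyBaskaranBrey2008]
#3 MomentumFluxResponse (crux) — MEAN MOMENTUM-CURRENT CLOSURE IN THE ONE DIRECTION (the momentum
clause of OneDirectionResponse as its own item): same prefix; ∀ j: Cov_{LG_N}(K_N,
⟨m_N(Φ_{N,s}z),χ⟩_j) → s∂_s∫χρ_su_{s,j} + ∫χρ_su_{s,j} UNIFORMLY in s ∈ [0,t]. By WardIdentity
(momentum clause) the left side is ∂_s(sE⟨m_N(s),χ⟩_j), so this is convergence of the MEAN MOMENTUM
CURRENT E⟨τ_{j·}(s),∇χ⟩ to ∫∂_kχ(ρu_ju_k + pδ_{jk}) (Spohn1991 §3.2 (3.7), virial theorem (3.15),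
(3.16); IrvingKirkwood1950): isotropy of the conditional velocity covariance (kinetic pressure ρθ𝟙)
plus the collisional virial → excess pressure of the hard-sphere EOS, in mean, about the true flow.
Second moments are bounded by the conserved energy, so no tail problem: the content is local
equilibrium proper for the stress. [difficulty: open-problem] (why it might fail: the mean stress
may keep an N-independent anisotropic / non-virial part at fixed small σ before the shock — the
closure problem in its weakest form; false also if the mean momentum flux oscillates at kinetic
frequency (uniformity in s).) [Spohn1991, IrvingKirkwood1950, AlderWainwright1970,
OllaVaradhanYau1993, DuftyBaskaranBrey2008, Duerinckx2021]
#4 MeanClosure (crux, rank 4; crux rank 3 at open, retriaged crux→support 2026-08-15 as 'standard, L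
to formalise', RE-KINDED crux 2026-08-16 by the
crux-only ruling — a load-bearing, unproved, size-L hypothesis of `closes` must be a crux; also crux
rank 6 of route ResponseRigidity) — MEAN ⇒ PROBABILITY BY ENTROPY SATURATION (card C2; card
entropy-saturation-mean-closure (a); packing-guarded): ∃ η > 0, ∀ continuous positive profiles ∃ σ₀
∀ σ ∈ (0,σ₀) ∀ classical hs-Euler solutions on [0,T) with packing < η, ∀ flow families with the t =
0 LLN, ∀ t < T: IF the expectations of the empirical density / momentum (componentwise) / energy
fields at time t converge for every smooth χ to ∫χρ_t, ∫χρ_tu_{t,j}, ∫χE_t, THEN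
TendstoHydroFieldsAt holds at t. Mechanism: S(f_t) = S(f_0) (Liouville), log ψ[a,u,θ] is LINEAR in
the empirical fields (hard core = common support, no pair energy), classical hs-Euler conserves ∫ρ
s(ρ,θ) ⇒ H(f_t | ψ[a_t,u_t,θ_t])/(N+1) = [S(ψ_t) − S(ψ_0)]/(N+1) − (linear statistic of the
mean-field errors) → 0; then the entropy inequality against the exponential concentration of the
reference local Gibbs law. Static inputs at packing < η: canonical inhomogeneous cluster expansion
(limits of N⁻¹log Z_N(a), N⁻¹S(ψ)), inverse activity–density map, C¹ virial EOS (shared items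
HsEosLowDensity 0768 / LocalGibbsConcentration 0767 in content). [difficulty: L] (why it might fail:
No dynamical content; risks are the statics as typed: a UNIFORM canonical (fixed N+1, inhomogeneous
activity) cluster expansion with o(1) entropy-per-particle control, and exact isentropy needs
hsExcessFreeEnergy ∈ C¹ on [0,η) so the limsup/deriv EOS of HardSphereEuler.lean is the true one.)
[Yau1991, OllaVaradhanYau1993, KipnisLandim1999, SaintRaymond2009, Ruelle1969, LebowitzPenrose1964,
Georgii1994]
#5 ResponseToMeans (crux since the crux-only repair 2026-08-16) — RESPONSE ⇒ MEANS, the Ward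
mechanism as ONE typed obligation:
MomentumFluxResponse → EnergyFluxResponse → MeanHydroLimitInBand (stated over the two flux cruxes —
textually above it in the route file — whose conjunction at a
common threshold is OneDirectionResponse: if the one athermal covariance converges uniformly on
[0,t] to (s∂_s + D′)U^E in the dilute band, the
EXPECTATIONS of the three empirical fields converge to the Euler fields at every t < T in the same
band; η := η_R, σ₀ := min(σ_R, 1/2)). It is
exactly the composite of four provable-now supports, ResponseToMeans = fun hRm hRe => WardToMeans
(oneDirectionResponse_of_flux hRm hRe) WardIdentity MeanMassContinuity
LocalGibbsStatics (Sketch.lean): the finite-N Ward identities (d/dc at c = 1 of the exponential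
family LG(a,cu,c²θ) transported by the flow = covariance with the score K;
ScalingCovariance = timeDilate + Gaussian change of variables), the Gaussian statics at t = 0, the
exact mean continuity equation, and one FTC on (0,t]
for sV_j(s), s²V_e(s). Ranked last: provable now, a crux only because a load-bearing unproved link
of `closes` must be one (human ruling 2026-08-16);
the natural first claim for an idle prover, in four independent pieces. [difficulty: L] (why it
might fail: only AS TYPED — differentiation in c under ∫
against localGibbsLaw ∘ Φ_t needs Gaussian-tail × conserved-energy domination and measurability of
the flow map; the boundary term sE⟨m_N(s),χ⟩ → 0
as s ↓ 0; `covariance` / Bochner junk values if an integrability side condition fails at some N.)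
[Spohn1991, DuftyBaskaranBrey2008, Glynn1990,
LebowitzPercusVerlet1967]
#9 OneDirectionResponse (support since the 2026-08-16 repair; crux rank 2 at open, refuter-vetted
2/2) — ONE-DIRECTION (ATHERMAL) RESPONSE (card C3): both covariance clauses together, i.e.
Cov_{LG_N}(K_N, U_N(Φ_{N,s}z)) → (s∂_s + D′)U^E uniformly on [0,t] in the dilute band; by
exchangeability the left side is (N+1)·E[κ(z₀)(E[F_s | z₀] − E F_s)], the conditional-mean response
of the time-s field to ONE tagged sphere paired with the fixed weight κ ∈ span{1, v·u₀, |v|²} ⊗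
C(𝕋³). RE-KINDED: it is exactly MomentumFluxResponse ∧ EnergyFluxResponse at a common threshold
(both directions one line of logic, Sketch2.lean), derived inside `closes` by a `have`; kept as the
decl WardToMeans consumes and as the handle for a unified proof of both closures. [Spohn1991,
DuftyBaskaranBrey2008, OllaVaradhanYau1993, Duerinckx2021]
(#4 DiluteSelfConsistency — shared item stmt-AtomisticToContinuum-3091 — DROPPED 2026-08-16: needed
only because the old unguarded conjunct fixed σ₀ before quantifying T and the solution, leaving the
packing ρ_t(x)σ³ unbounded; the retyped Statement (p126922) carries that guard itself, `closes`
instantiates its η₀ at min(η_R, η_M); the item keeps its other routes.)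
#9 ScalingCovariance (support) — MASTER IDENTITY (H) at the level of laws: for σ > 0, c > 0, t ≥ 0,
continuous profiles with θ₀ > 0, every N and flow Φ: lawAt Φ (localGibbsLaw σ a₀ (c·u₀) (c²θ₀) N Φ)
t = (scaleVel c)_# lawAt Φ (localGibbsLaw σ a₀ u₀ θ₀ N Φ) (ct) — "a hotter copy at time t is the
original at time ct". Proof: (scaleVel c)_# LG(a,u,θ) = LG(a,cu,c²θ) (Gaussian change of variables
on the velocity factor, `lintegral_localGibbsMeasure`; the configurational factor Π a(x_i)·1_D and
Z_N are untouched) and Φ_t ∘ scaleVel c = scaleVel c ∘ Φ_{ct} Liouville-a.e. (tree theorems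
`IsHardSphereTrajectory.timeDilate` + `HardSphereFlow.flow_eq_ae_holds` applied to the dilated flow
z ↦ scaleVel c (Φ_{ct}(scaleVel c⁻¹ z)); scaleVel preserves Liouville-null sets). Rests on PROVED
cone theorems only. [difficulty: provable-now] [DuftyBaskaranBrey2008, Serre2024, GST2013,
Alexander1975, CIP1994]
#9 WardIdentity (support) — WARD IDENTITIES (W_H) at finite N, derivative form: for σ > 0, t > 0,
continuous positive profiles, N, Φ and continuous χ, with P = localGibbsLaw σ a₀ u₀ θ₀ N Φ and K(z)
= Σ_i[(|v_i|² − ⟪v_i,u₀(x_i)⟫)/θ₀(x_i) − 3]: s ↦ E_P⟨n_N(Φ_s z),χ⟩ has derivative t⁻¹Cov_P(K,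
⟨n_N(Φ_t ·),χ⟩) at t; s ↦ s·E_P⟨m_N(Φ_s ·),χ⟩_j has derivative Cov_P(K, ⟨m_N(Φ_t ·),χ⟩_j) at t; s ↦
s²·E_P⟨e_N(Φ_s ·),χ⟩ has derivative t·Cov_P(K, ⟨e_N(Φ_t ·),χ⟩) at t — t∂_tV + D′V = Cov(·, K).
Proof: ScalingCovariance on the (0,1,2)-homogeneous fields gives E_{LG(a,cu,c²θ)}F(U(t)) =
E_{LG}[c^k F(U(ct))]; differentiate the exponential family in c at 1 under ∫ (Gaussian tails ×
energy-bounded fields) — the score is K, mean 0 — and read off kg(t) + tg′(t) on the right.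
[difficulty: provable-now] [DuftyBaskaranBrey2008, LebowitzPercusVerlet1967, Glynn1990, Spohn1991]
#9 MeanMassContinuity (support) — exact MEAN continuity equation at finite N (no collision term in
the mass flux): for σ > 0, continuous positive profiles, N, Φ, smooth χ, P the local Gibbs law: h(s)
:= E_P Σ_j⟨m_N(Φ_s z), ∂_jχ⟩_j is continuous on [0,∞) and s ↦ E_P⟨n_N(Φ_s z),χ⟩ has derivative h(t)
within [0,∞) at every t ≥ 0. Proof: pathwise FTC along piecewise-free trajectories (pos_continuous,
free, locFinite), energy-bounded integrand, dominated convergence; continuity of h because a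
collision at a FIXED time has P-probability 0 (P ≪ Liouville). [difficulty: provable-now]
[Spohn1991, GST2013, IrvingKirkwood1950]
#9 LocalGibbsStatics (support) — STATICS of the local Gibbs law (t = 0 input of the assembly): for
continuous positive profiles and 0 < σ < 1/2 there is C such that for every N, Φ, with P =
localGibbsLaw σ a₀ u₀ θ₀ N Φ: P is a probability measure (tree theorem
isProbabilityMeasure_localGibbsLaw); the kinetic energy per particle ⟨e_N,1⟩ is P-integrable with
mean ≤ C (C = sup|u₀|²/2 + (3/2)sup θ₀); and, because given the positions the velocities are
independent Gaussians N(u₀(x_i), θ₀(x_i)I) (lintegral_localGibbsMeasure), for every continuous χ the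
momentum and energy fields are integrable with E_P⟨m_N,χ⟩_j = E_P⟨n_N, χ·u₀,j⟩ and E_P⟨e_N,χ⟩ =
E_P⟨n_N, χ(|u₀|²/2 + 3θ₀/2)⟩ — so the t = 0 LLN for the bounded density field alone gives the t = 0
means of all three fields. [difficulty: provable-now] [Ruelle1969, GST2013, Spohn1991]
#9 ClockIdentity (support) — CLOCK MODE, exact at finite N (card use (2); negative-side / MD handle,
not a hypothesis of `closes`): for isothermal data at rest (u₀ ≡ 0, θ₀ ≡ θc > 0, continuous a₀ > 0),
σ > 0, t > 0, N, Φ, continuous χ: (2/θc)(N+1)·Cov_P(⟨n_N(Φ_t z),χ⟩, ⟨e_N(Φ_t z),1⟩) =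
t·(d/dt)E_P⟨n_N(Φ_t z),χ⟩ — the total-energy fluctuation is a random clock rate (WardIdentity,
density clause, with K = (2/θc)(N+1)⟨e_N,1⟩ − 3(N+1) and energy conservation P-a.e.). Under the
conjunct the right side → (θc/2)t∂_t∫χρ_t: an O(1/N) long-range density–energy correlation, linear
in t, present for canonical and absent for microcanonical local Gibbs data — an EOS-free
event-driven-MD test. [difficulty: provable-now] [LebowitzPercusVerlet1967, DoyonEtAl2023,
DoyonEtAl2023PRL, Glynn1990]
#9 WardToMeans (support) — GLUE (the analytic piece of the crux ResponseToMeans; the analytic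
assembly as a typed item; measure theory + one t-integration, no physics): OneDirectionResponse →
WardIdentity → MeanMassContinuity → LocalGibbsStatics → MeanHydroLimitInBand. η := η_R, σ₀ :=
min(σ_R, 1/2). MOMENTUM/ENERGY (t > 0): by WardIdentity s ↦ sV_j(s) (resp. s²V_e) is differentiable
on (0,t] with derivative the Ward covariance, which → (s g_j)′ (resp. (s²g_e)′) uniformly by
OneDirectionResponse (g smooth on [0,T) by IsSmoothSpaceTimeOn; derivWithin (Ico 0 T) = derivative),
and sV_j(s) → 0 as s ↓ 0 (energy bound of LocalGibbsStatics + conservation a.e. + Jensen), so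
tV_j(t) = ∫₀^t Cov_N → t g_j(t). t = 0: flow 0 = id P-a.e.; the density LLN with the bounded weights
χu₀,j, χ(|u₀|²/2 + 3θ₀/2) and the static identities give the three means. DENSITY (t > 0):
MeanMassContinuity makes V_n C¹ with V_n′ = Σ_j V_{∂_jχ,j} (bounded); the momentum step with test
functions ∂_jχ, dominated convergence in s, the mass equation and Torus.integral_divergence_eq_zero
give V_n(t) − V_n(0) → ∫χρ_t − ∫χρ_0. Full proof sketch in the item docstring. [difficulty:
provable-now] [Spohn1991, OllaVaradhanYau1993]

TWO-LAYER PLAN. Foreseen glued splits (nothing filed now; k ≤ 3, depth 1), one family under each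
flux crux: MomentumFluxResponse / EnergyFluxResponse ⇐
StaticDirection (s = 0: Cov → D′U₀ = (0, ρ₀u₀, 2E₀), Gaussian statics + t = 0 LLN, provable now) →
OneParticleMomentumGreen / OneParticleEnergyGreen
(the conserved-density projection of the one-particle influence function m_s paired with κ is
transported by linearised hs-Euler about the solution;
needs the definition LinearizedHsEuler requested earlier by OneParticleInfluence) → the crux (glue:
Cauchy–Schwarz + chain rule); the energy family
carries in addition a cubic-moment uniform-integrability child. MeanClosure ⇐
EntropySaturationIdentity
(|klDiv(lawAt … t ‖ ψ[a_t,u_t,θ_t])/(N+1) − Θ_N(t)| → 0) → GuardedGibbsConcentration (0767 with the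
packing guard and a C^k-ball of profiles)
→ MeanClosure (glue = entropy inequality). ResponseToMeans ⇐ WardIdentity → MeanMassContinuity →
LocalGibbsStatics → WardToMeans — all four already filed as top-level supports and the
glue is `fun hRm hRe => WardToMeans (odr hRm hRe) W C S` (one line of logic, Sketch.lean), so no
split is filed: proving the four supports proves the crux;
WardToMeans ⇐ (momentum/energy t > 0 step) → (density step) if a prover wants halves.

KILL CRITERIA. ¬MomentumFluxResponse or ¬EnergyFluxResponse (hence ¬OneDirectionResponse) at some
fixed small σ before the shock (an N-independent
non-Euler part of Cov(K_N, ⟨m_N(s),χ⟩) or Cov(K_N, ⟨e_N(s),χ⟩), i.e. of the mean momentum or energy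
flux, by analysis or MD extrapolation) closes the
route `refuted:<that crux>` and, with MeanClosure, is a summit-level negative for the guarded
conjunct. DenseExcursion (3090) / ¬DiluteSelfConsistency (3091) no longer touch this route: the
statement audit (D-0032, retype
p126922, 2026-08-16) adopted the packing-guarded conjunct as `_root_.HydrodynamicLimit` — the repair
foreseen here — and 3091 was dropped from
the route's items and from `closes` (it lives on in the other routes wanting it). ¬MeanClosure can
only come from a statics/EOS junk defect (hsPressure via
limsup/deriv): treat as an operator alarm, restate with an explicit C¹-EOS hypothesis.
ScalingCovariance / WardIdentity / ClockIdentity /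
LocalGibbsStatics / MeanMassContinuity / WardToMeans / ResponseToMeans refuted = a typing slip in an
exact finite-N identity or in the
measure-theoretic glue: restate at once (misstated class), the line is untouched. L2HydroFields
(0800) or RelEntropyVanishing (0766/9394-type targets) proved by any route moots the roles of
ResponseToMeans and MeanClosure; HydroLimitInBand (3093) IS now the conjunct
(`hydroLimitInBandDim_three_iff_root`): it or HydrodynamicLimit proved elsewhere closes the route
superseded.

NOT DECOMPOSED YET. The layer-2 children above; the boost Ward identity (W_G) (Cov with the momentum
score P = Σ(v_i − u₀)/θ₀ equals t⟨V,∂_aχ⟩ + G′_aV, no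
time derivative; torus-exact by HardSphereTranslation + Galilean covariance of collidePair) and the
pressure-free covariance form of the
momentum closure (card use (3)); the typed corollary HydroLimitInBand → ClockLaw (pointwise in t it
needs uniform integrability of the
collisional flux; time-integrated it is unconditional); real-analyticity of t ↦ E_{LG}F(U_N(t)) at
fixed N (card (3b)); any rate in N
(O(Kn) = O(N^{-1/3}) expected); the pathwise continuity equation and the no-atom-of-collision-times
lemma (helpers of MeanMassContinuity and
of the FTC step in WardToMeans, attached with --supports); d = 3 only; the static inputs of
MeanClosure are shared items 0767/0768, not
re-filed here.

CHEAPEST FALSIFIER. (i) Free flight (BoltzmannHypothesisBarrier's kernel idealGasState): Cov(K,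
⟨m_N(s),χ⟩) is explicit — ballistic transport of the
κ-imprint — and ≠ (s∂_s + 1)(ρu)^E for non-constant profiles: MomentumFluxResponse (likewise
EnergyFluxResponse) is not vacuous and fails exactly where Euler fails; for constant
profiles both sides agree identically at every N (LG is flow-invariant; on paper Cov_M(v_j,κ) = u_j,
Cov_M(|v|²/2,κ) = |u|² + 3θ = 2E/ρ,
E_Mκ = 0 — done). (ii) Re-derive (W_H) in five lines from (H): d/dc log M_{cu,c²θ}(v)|_{c=1} = (|v|²
− v·u)/θ − 3 (done). (iii) Event-driven
MD, φ = 0.05, N = 10³–10⁴, isothermal density pulse at rest: (2/θ)(N+1)Cov(cell density, ⟨e_N,1⟩) vs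
t × finite-difference d/dt of the
mean cell density — ClockIdentity is EXACT at finite N (code check + visibility of the clock mode at
CLT scale); kit not used in this
one-shot seat. (iv) Lookup: (W_H) for INHOMOGENEOUS nonequilibrium hard-sphere flows in print? DBB
2006–08: generator form about the
homogeneous cooling state; LPV 1967: equilibrium shadow; Spohn (7.16): equilibrium tilt — a hit
lowers novelty, not validity. (v) Lean,
done here: all items + `closes` elaborate (Sketch.lean rc 0, std axioms); re-elaborated 2026-08-16
against the guarded Statement, and again after the crux-only repair with FOUR crux hypotheses Rm,
Re, ResponseToMeans, M
(Sketch.lean rc 0, axioms propext / Classical.choice / Quot.sound; the old seven-hypothesis theorem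
is recovered from the new one by
`responseToMeans_of_supports`, so nothing was weakened).

NUMBERS. Fixed reduced density (N+1)ε³ = σ³; Kn ≍ (N+1)^{-1/3}; expected finite-N corrections to
OneDirectionResponse of relative size O(Kn)
(Navier–Stokes order). Score statistics under LG: E K = 0, Var K = (N+1)·E[6 + |u₀(x)|²/θ₀(x)] =
O(N); Var⟨m_N,χ⟩ = O(1/N) expected, so the
Ward covariance is O(1) = √N × N^{-1/2}. D′ = diag(0,1,2); static value Cov(K,U_N(0)) =
E⟨(n,m,e)·(0, χu₀, χ(|u₀|²+3θ₀))⟩ → (0, ρ₀u₀, 2E₀)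
exactly at each N. Clock mode: (N+1)Cov(⟨n_N,χ⟩,⟨e_N,1⟩) → (θ/2)·t·∂_t∫χρ_t, linear in t. Packing
guard η: any value below the radius of
HsEosLowDensity (0768) / LocalGibbsConcentration (0767) works for MeanClosure (hard-core cluster
expansion converges for activity
z < (e·(4π/3))^{-1} ≈ 0.088 in diameter units, Spohn1991 Cond. 2.1); freezing at packing fraction ≈
0.49 and close packing 0.7405 are far
outside. isProbabilityMeasure_localGibbsLaw needs σ ≤ 1/2 (grid-fit ratio ≥ 0.63). Items at open: 11
(1 target, 3 cruxes — one shared —,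
6 supports, 1 assembly) + `closes`; after retriage (2026-08-15) and the statement-retype repair
(2026-08-16): 12 (1 target, 2 cruxes = the two flux
closures cut from OneDirectionResponse, 8 supports incl. OneDirectionResponse and MeanClosure, 1
assembly) + `closes` (7 hypotheses); after the crux-only repair (2026-08-16, this
revision): 13 (1 target; 4 cruxes — EnergyFluxResponse 2, MomentumFluxResponse 3, MeanClosure 4,
ResponseToMeans 5; 7 supports; 1 assembly) +
`closes` (4 crux hypotheses).

DEFINITION REQUESTS. None to type the items (HardSphereEuler.lean objects, scaleVel, Mathlib
covariance / HasDerivAt / TendstoUniformlyOn / Measure.map). Layer 2 (OneParticleEnergyGreen) will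
reuse the definition LinearizedHsEuler requested by the
retired OneParticleInfluence (topic Literature/Analysis/FluidPDE). No cite facts requested: the
identities are proved from the cone, and
MeanClosure's statics are shared items 0767/0768 rather than named facts, so the route's items use
no unproved named fact (needs-fact: none). The six unproved named facts an import-level cone report
lists —
Literature HydrodynamicLimit / HydroLimitInBandDim / HydrodynamicLimitDim, FouriersLaw,
Crystallization, BoseEinsteinCondensation — enter only
through the operator's Statement.lean imports (the sub Statement imports the sibling conjuncts'
Literature files), are used by no item, and the
gate's constant-level cone of `closes` has 0 unproved dependencies (staffable); the route's one own
import, HardSphereTimeScaling, is proved and is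
needed by ScalingCovariance (scaleVel, timeDilate).

Novelty: Searches (2026-08-15, this seat): `lit search --hybrid "hard spheres velocity scaling temperature
time scale covariance identity score function
nonequilibrium mean fields"` (12 book rows, vector leg: March–Tosi 1976 pp. 50–51, CIP1994 p. 20 —
time-scale remark only); `lit galaxy search
--star all` ×3 substring probes ("…only sets the time scale", "velocity scaling operator": 0 rows)
and `--star pdf --mode bm25` on the identity in
prose (12: fluctuation theorems, thermostats, Hoover — none with a scaling Ward identity); `lit
frontier AtomisticToContinuum --since 2022` (30:
arXiv:2602.04407 Deng–Hani–Ma exposition, doi:10.1007/s10955-026-03570-w binary-collision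
fluctuations, arXiv:2310.13338 — nothing on scaling
identities); inherited from the card audit and the predecessor: crossref DBB
(doi:10.1103/physreve.77.031310 §7 read pp. 12, 23–24;
doi:10.1088/1742-5468/2006/08/l08002; doi:10.1088/1742-5468/2007/12/p12002), LPV
doi:10.1103/physrev.153.250, Glynn doi:10.1145/84537.84552,
BMFT doi:10.21468/scipostphys.15.4.136 / doi:10.1103/physrevlett.131.027101 /
doi:10.1088/1742-5468/adfe57, Spohn1991 pp. 88–89 (7.16).
Nearest prior art found: DuftyBaskaranBrey2008 (velocity-dilation generator conjugate to
temperature, exact for hard spheres, about the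
homogeneous cooling state) and LebowitzPercusVerlet1967 (equilibrium ensemble shadow); Spohn1991
(7.16) (equilibrium tilt identity).
Delta: the nonequilibrium two-time version forced by athermality for INHOMOGENEOUS local Gibbs
flows,  [refs: 10.1007/s10955-026-03570-w, 10.1103/physreve.77.031310, 10.1088/1742-5468/2006/08/l08002, 10.1088/1742-5468/2007/12/p12002, 10.1103/physrev.153.250, 10.1145/84537.84552, 10.21468/scipostphys.15.4.136, 10.1103/physrevlett.131.027101, 10.1088/1742-5468/adfe57, 2602.04407, 2310.13338, doi:10.1007/s10955-026-03570-w, doi:10.1103/physreve.77.031310, doi:10.1088/1742-5468/2006/08/l08002, doi:10.1088/174]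

Barriers (technique_class: exact-response-identity scaling-covariance score-function): - technique_class: exact-response-identity scaling-covariance score-function
- Literature.Barriers.AtomisticToContinuum.BoltzmannHypothesisBarrier: NOT evaded by the
flux-closure cruxes MomentumFluxResponse / EnergyFluxResponse (together = OneDirectionResponse) —
identifying the one-direction response (= the mean momentum / energy flux, by WardIdentity) is the
closure problem in its weakest form (mean, one scalar direction κ, pre-shock), and each crux visibly
FAILS for the barrier's ideal-gas kernel (free flight transports the κ-imprint ballistically); the
bet is that one direction of conditional-mean response about the true flow is the smallest carrier
of local equilibrium on the board. MeanClosure evades the barrier's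
classification-of-invariant-states form entirely: entropy is saturated by Liouville + isentropy, no
stationary-state input.
- Literature.Barriers.AtomisticToContinuum.MacroErgodicityBarrier: no ergodic decomposition of the
infinite-volume dynamics is invoked; the only dynamical input is a finite-N covariance limit.
- Literature.Barriers.AtomisticToContinuum.VelocityReversalBarrier: not met — statements are about
laws, expectations and covariances under the INITIAL local Gibbs law, conclusion in probability; (H)
at c = −1 composed with t ↦ −t is Loschmidt's symmetry and is used only for c > 0 (timeDilate is
stated for c > 0).
- Literature.Barriers.AtomisticToContinuum.HighMomentumCutoffBarrier: not met by the identities (K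
has Gaussian moments under LG; fields

History (route lifecycle, newest last):
- 2026-08-16T23:21:27Z · rev 5: restated Assembly (stmt-AtomisticToContinuum-11936) — route-repair step 3/4: Assembly restated to the exact type of the new deciding theorem and closes re-elaborated with SEVEN hypotheses (MomentumFluxResponse, Ene (planner-rrepair-AtomisticToContinuum-AthermalC-09248d41-0)
- 2026-08-16T23:22:40Z · rev 7: dropped DiluteSelfConsistency — route-repair step 5 (completes step 4, whose retriage pass applied only the re-kind + barriers): DROP DiluteSelfConsistency (shared stmt-AtomisticToContinuum-30 (planner-rrepair-AtomisticToContinuum-AthermalC-09248d41-0)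
- 2026-08-16T23:45:26Z · rev 10: restated ResponseToMeans (stmt-AtomisticToContinuum-17882), Assembly (stmt-AtomisticToContinuum-17523) — route-repair step 2/2 (crux-only ruling 2026-08-16): RESTATE the new crux ResponseToMeans (stmt-17882; rendered BLOCKED at rev 9 because a crux precedes the sup (planner-rbadge-AtomisticToContinuum-AthermalCl-687bdcd9-0)
- 2026-08-23T09:35:16Z · DORMANT — reconciler: no traction for 6 d (last activity statement-grounded at 2026-08-17T07:59:05Z); parked, not closed — `ledger route dormant route-AtomisticToContinuu (operator:999:2230771)

sub-problem: HydrodynamicLimit · status: dormant · opened planner-plancard-AtomisticToContinuum-Hydrody-8edbff45-g2-0 2026-08-15T18:46:05Z · rev 10 · ledger route-AtomisticToContinuum-AthermalClockWard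
GENERATED by the gate from the ledger (D-0016/17). Provers cite these decls: `theorem foo : Summit.AtomisticToContinuum.HydrodynamicLimit.Theses.AthermalClockWard.<Decl> := …` in Summits/AtomisticToContinuum/HydrodynamicLimit/Theorems/<Name>.lean.
-/

namespace Summit.AtomisticToContinuum.HydrodynamicLimit.Theses.AthermalClockWard

open scoped BigOperators Topology Manifold Classical MeasureTheory ProbabilityTheory Matrix InnerProductSpace ComplexConjugate ContinuousMap
open Filter Set Function TopologicalSpace MeasureTheory

attribute [summit_statement] _root_.HydrodynamicLimit

/-- item stmt-AtomisticToContinuum-11927 · target · rank 0 · open · by planner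
why it might fail: The guarded conjunct restricted to MEANS (⇔ conjunct given MeanClosure): fails iff local equilibrium fails to propagate in mean at fixed small σ before the first singularity; no mixing input is known for deterministic hard spheres at fixed density (Spohn1991 I.3 pp. 35–39; OVY1993 needs noise).
sources: Spohn1991, OllaVaradhanYau1993
[target] MEAN hydrodynamic limit in the dilute band (typed waypoint X_mean): ∃ η > 0, ∀ continuous
positive profiles ∃ σ₀ ∀ σ ∈ (0,σ₀), for every classical hs-Euler solution on [0,T) with packing
ρ_t(x)σ³ < η on [0,T), every flow family with the t = 0 LLN, every t < T and every smooth χ, the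
EXPECTATIONS under localGibbsLaw of the empirical density / momentum (componentwise) / energy fields
at time t converge to ∫χρ_t, ∫χρ_t u_{t,j}, ∫χE_t. Delivered by WardToMeans from R, W, C, S;
MeanClosure and DiluteSelfConsistency lift it to the conjunct inside `closes`. -/
@[route_item "route-AtomisticToContinuum-AthermalClockWard"]
def MeanHydroLimitInBand : Prop :=
  ∃ η : ℝ, 0 < η ∧ ∀ (a₀ θ₀ : Literature.MathematicalPhysics.KineticTheory.T3 → ℝ) (u₀ : Literature.MathematicalPhysics.KineticTheory.T3 → Literature.MathematicalPhysics.KineticTheory.V3), Continuous a₀ → Continuous θ₀ → Continuous u₀ → (∀ x, 0 < a₀ x) → (∀ x, 0 < θ₀ x) → ∃ σ₀ : ℝ, 0 < σ₀ ∧ ∀ σ : ℝ, 0 < σ → σ < σ₀ → ∀ (T : ℝ) (ρ θ : ℝ → Literature.MathematicalPhysics.KineticTheory.T3 → ℝ) (u : ℝ → Literature.MathematicalPhysics.KineticTheory.T3 → Literature.MathematicalPhysics.KineticTheory.V3), Literature.MathematicalPhysics.KineticTheory.IsHardSphereEulerSolution σ T ρ u θ → (∀ t ∈ Set.Ico 0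 T, ∀ x, ρ t x * σ ^ 3 < η) → ∀ Φ : (N : ℕ) → Literature.Analysis.FluidPDE.HardSphereFlow (Literature.Analysis.FluidPDE.Torus.geometry (Fin 3)) (Literature.MathematicalPhysics.KineticTheory.hsDiameter σ N) (N + 1), Literature.MathematicalPhysics.KineticTheory.TendstoHydroFieldsAt (fun N => Literature.MathematicalPhysics.KineticTheory.localGibbsLaw σ a₀ u₀ θ₀ N (Φ N)) Φ ρ u θ 0 → ∀ t ∈ Set.Ico 0 T, ∀ χ : Literature.MathematicalPhysics.KineticTheory.T3 → ℝ, Literature.Analysis.FunctionSpaces.Torus.IsSmooth χ → Filter.Tendsto (fun N : ℕ => ∫ z, Literature.MathematicalPhysics.KineticTheory.empiricalDensityField ((Φ N).flow t z) χ ∂(Literature.MathematicalPhysics.KineticTheory.localGibbsLaw σ a₀ u₀ θ₀ N (Φ N))) Filter.atTop (nhds (∫ x, χ x * ρ t x)) ∧ (∀ j : Fin 3, Filter.Tendsto (fun N : ℕ => ∫ z, Literature.MathematicalPhysics.KineticTheory.empiricalMomentumField ((Φ N).flow t z) χ j ∂(Literature.MathematicalPhysics.KineticTheory.localGibbsLaw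 σ a₀ u₀ θ₀ N (Φ N))) Filter.atTop (nhds (∫ x, χ x * ρ t x * u t x j))) ∧ Filter.Tendsto (fun N : ℕ => ∫ z, Literature.MathematicalPhysics.KineticTheory.empiricalEnergyField ((Φ N).flow t z) χ ∂(Literature.MathematicalPhysics.KineticTheory.localGibbsLaw σ a₀ u₀ θ₀ N (Φ N))) Filter.atTop (nhds (∫ x, χ x * Literature.MathematicalPhysics.KineticTheory.totalEnergyDensity (ρ t x) (u t x) (θ t x)))

/-- item stmt-AtomisticToContinuum-17509 · crux · rank 2 · open · by planner
why it might fail: By WardIdentity = uniform-in-s closure of the MEAN ENERGY CURRENT → (E+p)u (Spohn1991 (3.17)): needs the cubic velocity moment of f_s locally Maxwellian in mean at fixed small σ; no |v|³ uniform integrability along deterministic hard-sphere flow is known — false if a heat current survives in mean.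
sources: Spohn1991, BodineauGallagherSaintRaymondSimonella2023, OllaVaradhanYau1993, DuftyBaskaranBrey2008
[crux] MEAN ENERGY-CURRENT CLOSURE in the one (athermal) direction — the energy clause of
OneDirectionResponse as its own item (same prefix, packing-guarded): ∃ η > 0, ∀ continuous positive
profiles ∃ σ₀ ∀ σ ∈ (0,σ₀) ∀ classical hs-Euler solutions on [0,T) with packing ρ_t(x)σ³ < η, ∀ flow
families with the t = 0 LLN, ∀ t < T, ∀ smooth χ: with the initial energy score K_N(z) = Σ_i[(|v_i|²
− ⟪v_i,u₀(x_i)⟫)/θ₀(x_i) − 3], Cov_{LG_N}(K_N, ⟨e_N(Φ_{N,s}z),χ⟩) → s∂_s∫χE_s + 2∫χE_s UNIFORMLY in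
s ∈ [0,t]. By WardIdentity (energy clause) the left side is s⁻¹∂_s(s²E⟨e_N(s),χ⟩) at every finite N,
so the statement is the convergence of the MEAN ENERGY CURRENT E⟨j₄(s),∇χ⟩ to the Euler value
∫∇χ·(E_s + p_s)u_s, uniformly before t (Spohn1991 §3.2 (3.8), (3.14), (3.17), book pp. 35–36):
kinetic part = the cubic conditional velocity moment of f_s locally Maxwellian in mean (heat current
q = 0 at Euler order), collisional part = the mean collisional energy transfer. Ranked 2 (hardest):
the one place where high velocities enter the route
(Literature.Barriers.AtomisticToContinuum.HighMomentumCutoffBarrier), with only the conserved total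
energy as a priori control. Cut from OneDirectionResponse in the -/
@[route_item "route-AtomisticToContinuum-AthermalClockWard", crux]
def EnergyFluxResponse : Prop :=
  ∃ η : ℝ, 0 < η ∧ ∀ (a₀ θ₀ : Literature.MathematicalPhysics.KineticTheory.T3 → ℝ) (u₀ : Literature.MathematicalPhysics.KineticTheory.T3 → Literature.MathematicalPhysics.KineticTheory.V3), Continuous a₀ → Continuous θ₀ → Continuous u₀ → (∀ x, 0 < a₀ x) → (∀ x, 0 < θ₀ x) → ∃ σ₀ : ℝ, 0 < σ₀ ∧ ∀ σ : ℝ, 0 < σ → σ < σ₀ → ∀ (T : ℝ) (ρ θ : ℝ → Literature.MathematicalPhysics.KineticTheory.T3 → ℝ) (u : ℝ → Literature.MathematicalPhysics.KineticTheory.T3 → Literature.MathematicalPhysics.KineticTheory.V3), Literature.MathematicalPhysics.KineticTheory.IsHardSphereEulerSolution σ T ρ u θ → (∀ t ∈ Set.Ico 0 T, ∀ x, ρ t x * σ ^ 3 < η) → ∀ Φ : (N : ℕ) → Literature.Analysis.FluidPDE.HardSphereFlow (Literature.Analysis.FluidPDE.Torus.geometry (Fin 3)) (Literature.MathematicalPhysics.KineticTheory.hsDiameter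 σ N) (N + 1), Literature.MathematicalPhysics.KineticTheory.TendstoHydroFieldsAt (fun N => Literature.MathematicalPhysics.KineticTheory.localGibbsLaw σ a₀ u₀ θ₀ N (Φ N)) Φ ρ u θ 0 → ∀ t ∈ Set.Ico 0 T, ∀ χ : Literature.MathematicalPhysics.KineticTheory.T3 → ℝ, Literature.Analysis.FunctionSpaces.Torus.IsSmooth χ → let P : (N : ℕ) → MeasureTheory.Measure (Literature.Analysis.FluidPDE.Config (N + 1) (Fin 3) Literature.MathematicalPhysics.KineticTheory.T3) := fun N => Literature.MathematicalPhysics.KineticTheory.localGibbsLaw σ a₀ u₀ θ₀ N (Φ N); let K : (N : ℕ) → Literature.Analysis.FluidPDE.Config (N + 1) (Fin 3) Literature.MathematicalPhysics.KineticTheory.T3 → ℝ := fun _ z => ∑ i, ((‖(z i).2‖ ^ 2 - ⟪(z i).2, u₀ (z i).1⟫_ℝ) / θ₀ (z i).1 - 3); TendstoUniformlyOn (fun (N : ℕ) (s : ℝ) => ProbabilityTheory.covariance (K N) (fun z => Literature.MathematicalPhysics.KineticTheory.empiricalEnergyField ((Φ N).flow s z) χ) (P N)) (fun s => s * derivWithin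 (fun s' => ∫ x, χ x * Literature.MathematicalPhysics.KineticTheory.totalEnergyDensity (ρ s' x) (u s' x) (θ s' x)) (Set.Ico 0 T) s + 2 * ∫ x, χ x * Literature.MathematicalPhysics.KineticTheory.totalEnergyDensity (ρ s x) (u s x) (θ s x)) Filter.atTop (Set.Icc 0 t)

/-- item stmt-AtomisticToContinuum-11929 · crux · rank 3 · closed · proved by Summit.AtomisticToContinuum.HydrodynamicLimit.Theorems.RestartPrinciple.AgeDuhamelForgetting.meanClosure_holds @ d2307c2802e2 (prover) · by planner
why it might fail: No dynamical content; risks are the statics as typed: a UNIFORM canonical (fixed N+1, inhomogeneous activity) cluster expansion with o(1) entropy-per-particle control, and exact isentropy needs hsExcessFreeEnergy ∈ C¹ on [0,η) so the limsup/deriv EOS of HardSphereEuler.lean is the true one.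
sources: Yau1991, OllaVaradhanYau1993, KipnisLandim1999, Ruelle1969, LebowitzPenrose1964, GeorgiiZessin1993
[crux] MEAN ⇒ PROBABILITY BY ENTROPY SATURATION (card C2; card entropy-saturation-mean-closure (a);
packing-guarded): ∃ η > 0, ∀ continuous positive profiles ∃ σ₀ ∀ σ ∈ (0,σ₀) ∀ classical hs-Euler
solutions on [0,T) with packing < η, ∀ flow families with the t = 0 LLN, ∀ t < T: IF the
expectations of the empirical density / momentum (componentwise) / energy fields at time t converge
for every smooth χ to ∫χρ_t, ∫χρ_tu_{t,j}, ∫χE_t, THEN TendstoHydroFieldsAt holds at t. Mechanism: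
S(f_t) = S(f_0) (Liouville), log ψ[a,u,θ] is LINEAR in the empirical fields (hard core = common
support, no pair energy), classical hs-Euler conserves ∫ρ s(ρ,θ) ⇒ H(f_t | ψ[a_t,u_t,θ_t])/(N+1) =
[S(ψ_t) − S(ψ_0)]/(N+1) − (linear statistic of the mean-field errors) → 0; then the entropy
inequality against the exponential concentration of the reference local Gibbs law. Static inputs at
packing < η: canonical inhomogeneous cluster expansion (limits of N⁻¹log Z_N(a), N⁻¹S(ψ)), inverse
activity–density map, C¹ virial EOS (shared items HsEosLowDensity 0768 / LocalGibbsConcentration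
0767 in content). [difficulty: L] -/
@[route_item "route-AtomisticToContinuum-AthermalClockWard", crux]
def MeanClosure : Prop :=
  ∃ η : ℝ, 0 < η ∧ ∀ (a₀ θ₀ : Literature.MathematicalPhysics.KineticTheory.T3 → ℝ) (u₀ : Literature.MathematicalPhysics.KineticTheory.T3 → Literature.MathematicalPhysics.KineticTheory.V3), Continuous a₀ → Continuous θ₀ → Continuous u₀ → (∀ x, 0 < a₀ x) → (∀ x, 0 < θ₀ x) → ∃ σ₀ : ℝ, 0 < σ₀ ∧ ∀ σ : ℝ, 0 < σ → σ < σ₀ → ∀ (T : ℝ) (ρ θ : ℝ → Literature.MathematicalPhysics.KineticTheory.T3 → ℝ) (u : ℝ → Literature.MathematicalPhysics.KineticTheory.T3 → Literature.MathematicalPhysics.KineticTheory.V3), Literature.MathematicalPhysics.KineticTheory.IsHardSphereEulerSolution σ T ρ u θ → (∀ t ∈ Set.Ico 0 T, ∀ x, ρ t x * σ ^ 3 < η) → ∀ Φ : (N : ℕ) → Literature.Analysis.FluidPDE.HardSphereFlow (Literature.Analysis.FluidPDE.Torus.geometry (Fin 3)) (Literature.MathematicalPhysics.KineticTheory.hsDiameter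 σ N) (N + 1), Literature.MathematicalPhysics.KineticTheory.TendstoHydroFieldsAt (fun N => Literature.MathematicalPhysics.KineticTheory.localGibbsLaw σ a₀ u₀ θ₀ N (Φ N)) Φ ρ u θ 0 → ∀ t ∈ Set.Ico 0 T, (∀ χ : Literature.MathematicalPhysics.KineticTheory.T3 → ℝ, Literature.Analysis.FunctionSpaces.Torus.IsSmooth χ → Filter.Tendsto (fun N : ℕ => ∫ z, Literature.MathematicalPhysics.KineticTheory.empiricalDensityField ((Φ N).flow t z) χ ∂(Literature.MathematicalPhysics.KineticTheory.localGibbsLaw σ a₀ u₀ θ₀ N (Φ N))) Filter.atTop (nhds (∫ x, χ x * ρ t x)) ∧ (∀ j : Fin 3, Filter.Tendsto (fun N : ℕ => ∫ z, Literature.MathematicalPhysics.KineticTheory.empiricalMomentumField ((Φ N).flow t z) χ j ∂(Literature.MathematicalPhysics.KineticTheory.localGibbsLaw σ a₀ u₀ θ₀ N (Φ N))) Filter.atTop (nhds (∫ x, χ x * ρ t x * u t x j))) ∧ Filter.Tendsto (fun N : ℕ => ∫ z, Literature.MathematicalPhysics.KineticTheory.empiricalEnergyField ((Φ N).flow t z)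 χ ∂(Literature.MathematicalPhysics.KineticTheory.localGibbsLaw σ a₀ u₀ θ₀ N (Φ N))) Filter.atTop (nhds (∫ x, χ x * Literature.MathematicalPhysics.KineticTheory.totalEnergyDensity (ρ t x) (u t x) (θ t x)))) → Literature.MathematicalPhysics.KineticTheory.TendstoHydroFieldsAt (fun N => Literature.MathematicalPhysics.KineticTheory.localGibbsLaw σ a₀ u₀ θ₀ N (Φ N)) Φ ρ u θ t

/-- `MeanClosure` holds: proved by `Summit.AtomisticToContinuum.HydrodynamicLimit.Theorems.RestartPrinciple.AgeDuhamelForgetting.meanClosure_holds` @ d2307c2802e2. -/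
theorem MeanClosure_holds : MeanClosure := _root_.Summit.AtomisticToContinuum.HydrodynamicLimit.Theorems.RestartPrinciple.AgeDuhamelForgetting.meanClosure_holds

/-- item stmt-AtomisticToContinuum-17510 · crux · rank 3 · open · by planner
why it might fail: By WardIdentity = uniform-in-s closure of the MEAN MOMENTUM CURRENT → ρu⊗u + p𝟙 (Spohn1991 (3.15)–(3.16)): second moments are energy-bounded, but an N-independent anisotropic / non-virial part of the mean stress at fixed small σ before the shock makes it false — the closure problem proper.
sources: Spohn1991, IrvingKirkwood1950, AlderWainwright1970, OllaVaradhanYau1993, DuftyBaskaranBrey2008, Duerinckx2021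
[crux] MEAN MOMENTUM-CURRENT CLOSURE in the one (athermal) direction — the momentum clause of
OneDirectionResponse as its own item (same prefix, packing-guarded): … ∀ t < T, ∀ smooth χ, ∀ j:
Cov_{LG_N}(K_N, ⟨m_N(Φ_{N,s}z),χ⟩_j) → s∂_s∫χρ_su_{s,j} + ∫χρ_su_{s,j} UNIFORMLY in s ∈ [0,t]. By
WardIdentity (momentum clause) the left side is ∂_s(sE⟨m_N(s),χ⟩_j) at every finite N, so the
statement is the convergence of the MEAN MOMENTUM CURRENT E⟨τ_{j·}(s),∇χ⟩ to ∫∂_kχ(ρu_ju_k +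
pδ_{jk}), uniformly before t (Spohn1991 §3.2 (3.7), virial theorem (3.15), (3.16), book pp. 35–36;
IrvingKirkwood1950): isotropy of the conditional velocity covariance (kinetic pressure ρθ𝟙) plus the
collisional virial → the excess pressure of the hard-sphere EOS, in mean, about the true flow.
Second moments are bounded by the conserved energy (no tail problem): the content is local
equilibrium proper for the stress. At s = 0 it is Gaussian statics + the t = 0 LLN (Cov → ρ₀u₀,j;
foreseen child StaticDirection). Cut from OneDirectionResponse in the statement-retype repair
2026-08-16. [deps: WardIdentity, LocalGibbsStatics] [difficulty: open-problem] -/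
@[route_item "route-AtomisticToContinuum-AthermalClockWard", crux]
def MomentumFluxResponse : Prop :=
  ∃ η : ℝ, 0 < η ∧ ∀ (a₀ θ₀ : Literature.MathematicalPhysics.KineticTheory.T3 → ℝ) (u₀ : Literature.MathematicalPhysics.KineticTheory.T3 → Literature.MathematicalPhysics.KineticTheory.V3), Continuous a₀ → Continuous θ₀ → Continuous u₀ → (∀ x, 0 < a₀ x) → (∀ x, 0 < θ₀ x) → ∃ σ₀ : ℝ, 0 < σ₀ ∧ ∀ σ : ℝ, 0 < σ → σ < σ₀ → ∀ (T : ℝ) (ρ θ : ℝ → Literature.MathematicalPhysics.KineticTheory.T3 → ℝ) (u : ℝ → Literature.MathematicalPhysics.KineticTheory.T3 → Literature.MathematicalPhysics.KineticTheory.V3), Literature.MathematicalPhysics.KineticTheory.IsHardSphereEulerSolution σ T ρ u θ → (∀ t ∈ Set.Ico 0 T, ∀ x, ρ t x * σ ^ 3 < η) → ∀ Φ : (N : ℕ) → Literature.Analysis.FluidPDE.HardSphereFlow (Literature.Analysis.FluidPDE.Torus.geometry (Fin 3)) (Literature.MathematicalPhysics.KineticTheory.hsDiameter σ N) (N + 1),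 Literature.MathematicalPhysics.KineticTheory.TendstoHydroFieldsAt (fun N => Literature.MathematicalPhysics.KineticTheory.localGibbsLaw σ a₀ u₀ θ₀ N (Φ N)) Φ ρ u θ 0 → ∀ t ∈ Set.Ico 0 T, ∀ χ : Literature.MathematicalPhysics.KineticTheory.T3 → ℝ, Literature.Analysis.FunctionSpaces.Torus.IsSmooth χ → let P : (N : ℕ) → MeasureTheory.Measure (Literature.Analysis.FluidPDE.Config (N + 1) (Fin 3) Literature.MathematicalPhysics.KineticTheory.T3) := fun N => Literature.MathematicalPhysics.KineticTheory.localGibbsLaw σ a₀ u₀ θ₀ N (Φ N); let K : (N : ℕ) → Literature.Analysis.FluidPDE.Config (N + 1) (Fin 3) Literature.MathematicalPhysics.KineticTheory.T3 → ℝ := fun _ z => ∑ i, ((‖(z i).2‖ ^ 2 - ⟪(z i).2, u₀ (z i).1⟫_ℝ) / θ₀ (z i).1 - 3); ∀ j : Fin 3, TendstoUniformlyOn (fun (N : ℕ) (s : ℝ) => ProbabilityTheory.covariance (K N) (fun z => Literature.MathematicalPhysics.KineticTheory.empiricalMomentumField ((Φ N).flow s z) χ j) (P N)) (fun s => s * derivWithin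 (fun s' => ∫ x, χ x * ρ s' x * u s' x j) (Set.Ico 0 T) s + ∫ x, χ x * ρ s x * u s x j) Filter.atTop (Set.Icc 0 t)

-- earlier ResponseToMeans (stmt-AtomisticToContinuum-17882, replaced 2026-08-16T23:45:26Z -> stmt-AtomisticToContinuum-17926): retired by None — OneDirectionResponse → MeanHydroLimitInBand
/-- item stmt-AtomisticToContinuum-17926 · crux · rank 5 · open · by planner
why it might fail: Provable in content (finite-N Ward identities + Gaussian statics + one FTC); fails only AS TYPED: d/dc under ∫ against localGibbsLaw∘Φ_t needs Gaussian-tail × energy domination and flow measurability; covariance/Bochner junk values if an integrability side condition fails at some N.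
sources: Spohn1991, DuftyBaskaranBrey2008, Glynn1990, LebowitzPercusVerlet1967
[crux] RESPONSE ⇒ MEANS — the Ward mechanism as ONE typed obligation (crux by the crux-only ruling
of 2026-08-16: a load-bearing unproved link of `closes` must be a crux; provable now in content):
MomentumFluxResponse → EnergyFluxResponse → MeanHydroLimitInBand, stated over the two flux cruxes
(textually above it in the route file; their conjunction at a common threshold is
OneDirectionResponse, `oneDirectionResponse_of_flux`), i.e. if the one athermal covariance
Cov_{LG_N}(K_N, U_N(Φ_{N,s}z)) converges uniformly on [0,t] to (s∂_s + D′)U^E in the dilute band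
(η_R := min(η_Rm, η_Re)), then the EXPECTATIONS of the empirical density / momentum / energy fields
under localGibbsLaw converge to ∫χρ_t, ∫χρ_t u_{t,j}, ∫χE_t at every t < T in the same band (η :=
η_R, σ₀ := min(σ_R, 1/2)). It is exactly the composite of four provable-now SUPPORT items already
filed in this route: ResponseToMeans = fun hRm hRe => WardToMeans (odr hRm hRe) WardIdentity
MeanMassContinuity LocalGibbsStatics (Sketch.lean) — WardIdentity (t∂_tV + D′V = Cov(·,K) at finite
N: ScalingCovariance = timeDilate + Gaussian change of variables, differentiated in c at 1 under ∫,
score K of mean 0), LocalGibbsStatics (probabi -/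
@[route_item "route-AtomisticToContinuum-AthermalClockWard", crux]
def ResponseToMeans : Prop :=
  MomentumFluxResponse → EnergyFluxResponse → MeanHydroLimitInBand

/-- item stmt-AtomisticToContinuum-11928 · support · rank 2 · open · by planner
why it might fail: Modulo the exact WardIdentity: the MEAN momentum/energy fluxes are the Euler fluxes uniformly on [0,t] at fixed small σ — local-equilibrium closure in mean (Spohn1991 (3.13)–(3.14), open). False if a tagged sphere's κ-imprint keeps an N-independent non-Euler part over ≍N^{1/3} collisions.
sources: Spohn1991, OllaVaradhanYau1993, DuftyBaskaranBrey2008, AlderWainwright1970, BodineauGallagherSaintRaymondSimonella2023, Duerinckx2021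
[crux] ONE-DIRECTION (ATHERMAL) RESPONSE (card C3, packing-guarded): ∃ η > 0, ∀ continuous positive
profiles ∃ σ₀ ∀ σ ∈ (0,σ₀) ∀ classical hs-Euler solutions on [0,T) with packing < η, ∀ flow families
with the t = 0 LLN, ∀ t < T, ∀ smooth χ: with the initial ENERGY SCORE K_N(z) = Σ_i[(|v_i|² −
⟪v_i,u₀(x_i)⟫)/θ₀(x_i) − 3] (the c-derivative at c = 1 of log localGibbsLaw σ a₀ (cu₀) (c²θ₀); mean
zero) the covariances Cov_{LG_N}(K_N, ⟨m_N(Φ_{N,s}z),χ⟩_j) (j = 1,2,3) and Cov_{LG_N}(K_N,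
⟨e_N(Φ_{N,s}z),χ⟩) converge UNIFORMLY in s ∈ [0,t] to s∂_s∫χρ_su_{s,j} + ∫χρ_su_{s,j} and s∂_s∫χE_s
+ 2∫χE_s, i.e. to (s∂_s + D′)U^E. By exchangeability the left side is (N+1)·E[κ(z₀)(E[F_s | z₀] − E
F_s)]: the conditional-mean response of the time-s field to ONE tagged sphere paired with the fixed
weight κ ∈ span{1, v·u₀, |v|²} ⊗ C(𝕋³) — one direction of nonequilibrium linear response, which
WardIdentity identifies with ∂_s(sE⟨m_N(s),χ⟩_j), resp. s⁻¹∂_s(s²E⟨e_N(s),χ⟩), at every finite N.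
[difficulty: open-problem] -/
@[route_item "route-AtomisticToContinuum-AthermalClockWard"]
def OneDirectionResponse : Prop :=
  ∃ η : ℝ, 0 < η ∧ ∀ (a₀ θ₀ : Literature.MathematicalPhysics.KineticTheory.T3 → ℝ) (u₀ : Literature.MathematicalPhysics.KineticTheory.T3 → Literature.MathematicalPhysics.KineticTheory.V3), Continuous a₀ → Continuous θ₀ → Continuous u₀ → (∀ x, 0 < a₀ x) → (∀ x, 0 < θ₀ x) → ∃ σ₀ : ℝ, 0 < σ₀ ∧ ∀ σ : ℝ, 0 < σ → σ < σ₀ → ∀ (T : ℝ) (ρ θ : ℝ → Literature.MathematicalPhysics.KineticTheory.T3 → ℝ) (u : ℝ → Literature.MathematicalPhysics.KineticTheory.T3 → Literature.MathematicalPhysics.KineticTheory.V3), Literature.MathematicalPhysics.KineticTheory.IsHardSphereEulerSolution σ T ρ u θ → (∀ t ∈ Set.Ico 0 T, ∀ x, ρ t x * σ ^ 3 < η) → ∀ Φ : (N : ℕ) → Literature.Analysis.FluidPDE.HardSphereFlow (Literature.Analysis.FluidPDE.Torus.geometry (Fin 3)) (Literature.MathematicalPhysics.KineticTheory.hsDiameter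 σ N) (N + 1), Literature.MathematicalPhysics.KineticTheory.TendstoHydroFieldsAt (fun N => Literature.MathematicalPhysics.KineticTheory.localGibbsLaw σ a₀ u₀ θ₀ N (Φ N)) Φ ρ u θ 0 → ∀ t ∈ Set.Ico 0 T, ∀ χ : Literature.MathematicalPhysics.KineticTheory.T3 → ℝ, Literature.Analysis.FunctionSpaces.Torus.IsSmooth χ → let P : (N : ℕ) → MeasureTheory.Measure (Literature.Analysis.FluidPDE.Config (N + 1) (Fin 3) Literature.MathematicalPhysics.KineticTheory.T3) := fun N => Literature.MathematicalPhysics.KineticTheory.localGibbsLaw σ a₀ u₀ θ₀ N (Φ N); let K : (N : ℕ) → Literature.Analysis.FluidPDE.Config (N + 1) (Fin 3) Literature.MathematicalPhysics.KineticTheory.T3 → ℝ := fun _ z => ∑ i, ((‖(z i).2‖ ^ 2 - ⟪(z i).2, u₀ (z i).1⟫_ℝ) / θ₀ (z i).1 - 3); (∀ j : Fin 3, TendstoUniformlyOn (fun (N : ℕ) (s : ℝ) => ProbabilityTheory.covariance (K N) (fun z => Literature.MathematicalPhysics.KineticTheory.empiricalMomentumField ((Φ N).flow s z) χ j) (P N))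 (fun s => s * derivWithin (fun s' => ∫ x, χ x * ρ s' x * u s' x j) (Set.Ico 0 T) s + ∫ x, χ x * ρ s x * u s x j) Filter.atTop (Set.Icc 0 t)) ∧ TendstoUniformlyOn (fun (N : ℕ) (s : ℝ) => ProbabilityTheory.covariance (K N) (fun z => Literature.MathematicalPhysics.KineticTheory.empiricalEnergyField ((Φ N).flow s z) χ) (P N)) (fun s => s * derivWithin (fun s' => ∫ x, χ x * Literature.MathematicalPhysics.KineticTheory.totalEnergyDensity (ρ s' x) (u s' x) (θ s' x)) (Set.Ico 0 T) s + 2 * ∫ x, χ x * Literature.MathematicalPhysics.KineticTheory.totalEnergyDensity (ρ s x) (u s x) (θ s x)) Filter.atTop (Set.Icc 0 t)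

/-- item stmt-AtomisticToContinuum-11930 · support · rank 9 · open · by planner
sources: DuftyBaskaranBrey2008, Serre2024, GST2013, Alexander1975, CIP1994
[support] MASTER IDENTITY (H) at the level of laws: for σ > 0, c > 0, t ≥ 0, continuous profiles
with θ₀ > 0, every N and flow Φ: lawAt Φ (localGibbsLaw σ a₀ (c·u₀) (c²θ₀) N Φ) t = (scaleVel c)_#
lawAt Φ (localGibbsLaw σ a₀ u₀ θ₀ N Φ) (ct) — "a hotter copy at time t is the original at time ct".
Proof: (scaleVel c)_# LG(a,u,θ) = LG(a,cu,c²θ) (Gaussian change of variables on the velocity factor,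
`lintegral_localGibbsMeasure`; the configurational factor Π a(x_i)·1_D and Z_N are untouched) and
Φ_t ∘ scaleVel c = scaleVel c ∘ Φ_{ct} Liouville-a.e. (tree theorems
`IsHardSphereTrajectory.timeDilate` + `HardSphereFlow.flow_eq_ae_holds` applied to the dilated flow
z ↦ scaleVel c (Φ_{ct}(scaleVel c⁻¹ z)); scaleVel preserves Liouville-null sets). Rests on PROVED
cone theorems only. [difficulty: provable-now] -/
@[route_item "route-AtomisticToContinuum-AthermalClockWard"]
def ScalingCovariance : Prop :=
  ∀ (σ c t : ℝ), 0 < σ → 0 < c → 0 ≤ t → ∀ (a₀ θ₀ : Literature.MathematicalPhysics.KineticTheory.T3 → ℝ) (u₀ : Literature.MathematicalPhysics.KineticTheory.T3 → Literature.MathematicalPhysics.KineticTheory.V3), Continuous a₀ → Continuous θ₀ → Continuous u₀ → (∀ x, 0 < θ₀ x) → ∀ (N : ℕ) (Φ : Literature.Analysis.FluidPDE.HardSphereFlow (Literature.Analysis.FluidPDE.Torus.geometry (Fin 3)) (Literature.MathematicalPhysics.KineticTheory.hsDiameter σ N) (N + 1)), Φ.lawAt (Literature.MathematicalPhysics.KineticTheory.localGibbsLaw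 σ a₀ (fun x => c • u₀ x) (fun x => c ^ 2 * θ₀ x) N Φ) t = (Φ.lawAt (Literature.MathematicalPhysics.KineticTheory.localGibbsLaw σ a₀ u₀ θ₀ N Φ) (c * t)).map (Literature.Analysis.FluidPDE.scaleVel c)

/-- item stmt-AtomisticToContinuum-11931 · support · rank 9 · open · by planner
sources: DuftyBaskaranBrey2008, LebowitzPercusVerlet1967, Glynn1990, Spohn1991
[support] WARD IDENTITIES (W_H) at finite N, derivative form: for σ > 0, t > 0, continuous positive
profiles, N, Φ and continuous χ, with P = localGibbsLaw σ a₀ u₀ θ₀ N Φ and K(z) = Σ_i[(|v_i|² −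
⟪v_i,u₀(x_i)⟫)/θ₀(x_i) − 3]: s ↦ E_P⟨n_N(Φ_s z),χ⟩ has derivative t⁻¹Cov_P(K, ⟨n_N(Φ_t ·),χ⟩) at t;
s ↦ s·E_P⟨m_N(Φ_s ·),χ⟩_j has derivative Cov_P(K, ⟨m_N(Φ_t ·),χ⟩_j) at t (each j); s ↦
s²·E_P⟨e_N(Φ_s ·),χ⟩ has derivative t·Cov_P(K, ⟨e_N(Φ_t ·),χ⟩) at t — i.e. t∂_tV + D′V = Cov(·, K).
Proof: expectations of the (0,1,2)-homogeneous fields in ScalingCovariance give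
E_{LG(a,cu,c²θ)}F(U(t)) = E_{LG}[c^k F(U(ct))]; the left side is an exponential family in c
(differentiate under ∫ for c near 1: ratio of Maxwellians × polynomial, Gaussian tails ×
energy-bounded fields, energy conserved on the good set by configEnergy_eq_holds), its c-derivative
at 1 is the covariance with the score K (d/dc log M_{cu,c²θ}(v)|_{c=1} = (|v|² − v·u)/θ − 3, mean
0); the right side c^k g(ct) is then differentiable in c at 1, hence g at t, with derivative kg(t) +
tg′(t). If P = 0 (spheres do not fit) both sides vanish. [difficulty: provable-now] -/
@[route_item "route-AtomisticToContinuum-AthermalClockWard"]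
def WardIdentity : Prop :=
  ∀ (σ t : ℝ), 0 < σ → 0 < t → ∀ (a₀ θ₀ : Literature.MathematicalPhysics.KineticTheory.T3 → ℝ) (u₀ : Literature.MathematicalPhysics.KineticTheory.T3 → Literature.MathematicalPhysics.KineticTheory.V3), Continuous a₀ → Continuous θ₀ → Continuous u₀ → (∀ x, 0 < a₀ x) → (∀ x, 0 < θ₀ x) → ∀ (N : ℕ) (Φ : Literature.Analysis.FluidPDE.HardSphereFlow (Literature.Analysis.FluidPDE.Torus.geometry (Fin 3)) (Literature.MathematicalPhysics.KineticTheory.hsDiameter σ N) (N + 1)) (χ : Literature.MathematicalPhysics.KineticTheory.T3 → ℝ), Continuous χ → let P : MeasureTheory.Measure (Literature.Analysis.FluidPDE.Config (N + 1) (Fin 3) Literature.MathematicalPhysics.KineticTheory.T3) := Literature.MathematicalPhysics.KineticTheory.localGibbsLaw σ a₀ u₀ θ₀ N Φ; let K : Literature.Analysis.FluidPDE.Config (N + 1) (Fin 3) Literature.MathematicalPhysics.KineticTheory.T3 → ℝ := fun z => ∑ i, ((‖(z i).2‖ ^ 2 - ⟪(z i).2, u₀ (z i).1⟫_ℝ)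 / θ₀ (z i).1 - 3); HasDerivAt (fun s : ℝ => ∫ z, Literature.MathematicalPhysics.KineticTheory.empiricalDensityField (Φ.flow s z) χ ∂P) (t⁻¹ * ProbabilityTheory.covariance K (fun z => Literature.MathematicalPhysics.KineticTheory.empiricalDensityField (Φ.flow t z) χ) P) t ∧ (∀ j : Fin 3, HasDerivAt (fun s : ℝ => s * ∫ z, Literature.MathematicalPhysics.KineticTheory.empiricalMomentumField (Φ.flow s z) χ j ∂P) (ProbabilityTheory.covariance K (fun z => Literature.MathematicalPhysics.KineticTheory.empiricalMomentumField (Φ.flow t z) χ j) P) t) ∧ HasDerivAt (fun s : ℝ => s ^ 2 * ∫ z, Literature.MathematicalPhysics.KineticTheory.empiricalEnergyField (Φ.flow s z) χ ∂P) (t * ProbabilityTheory.covariance K (fun z => Literature.MathematicalPhysics.KineticTheory.empiricalEnergyField (Φ.flow t z) χ) P) t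

/-- item stmt-AtomisticToContinuum-11932 · support · rank 9 · open · by planner
sources: Spohn1991, GST2013, IrvingKirkwood1950
[support] exact MEAN continuity equation at finite N (no collision term enters the mass flux): for σ
> 0, continuous positive profiles, N, Φ and smooth χ, with P the local Gibbs law: h(s) := E_P
Σ_j⟨m_N(Φ_s z), ∂_jχ⟩_j is continuous on [0,∞) and s ↦ E_P⟨n_N(Φ_s z),χ⟩ has derivative h(t) within
[0,∞) at every t ≥ 0. Proof: positions are continuous and piecewise free (IsHardSphereTrajectory:
pos_continuous, free, locFinite), so pathwise ⟨n_N(Φ_t z),χ⟩ − ⟨n_N(z),χ⟩ = ∫₀^t Σ_j⟨m_N(Φ_s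
z),∂_jχ⟩_j ds for good z, integrand bounded by ‖∇χ‖_∞(2⟨e_N(z),1⟩)^{1/2} (configEnergy_eq_holds,
Cauchy–Schwarz); dominated convergence of difference quotients; continuity of h because a collision
at a FIXED time has P-probability 0 (contact sets are Liouville-null, Φ_s is measure preserving, P ≪
Liouville by localGibbsMeasure_absolutelyContinuous). [difficulty: provable-now] -/
@[route_item "route-AtomisticToContinuum-AthermalClockWard"]
def MeanMassContinuity : Prop :=
  ∀ σ : ℝ, 0 < σ → ∀ (a₀ θ₀ : Literature.MathematicalPhysics.KineticTheory.T3 → ℝ) (u₀ : Literature.MathematicalPhysics.KineticTheory.T3 → Literature.MathematicalPhysics.KineticTheory.V3), Continuous a₀ → Continuous θ₀ → Continuous u₀ → (∀ x, 0 < a₀ x) → (∀ x, 0 < θ₀ x) → ∀ (N : ℕ) (Φ : Literature.Analysis.FluidPDE.HardSphereFlow (Literature.Analysis.FluidPDE.Torus.geometry (Fin 3)) (Literature.MathematicalPhysics.KineticTheory.hsDiameter σ N) (N + 1)) (χ : Literature.MathematicalPhysics.KineticTheory.T3 → ℝ), Literature.Analysis.FunctionSpaces.Torus.IsSmooth χ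 → let P : MeasureTheory.Measure (Literature.Analysis.FluidPDE.Config (N + 1) (Fin 3) Literature.MathematicalPhysics.KineticTheory.T3) := Literature.MathematicalPhysics.KineticTheory.localGibbsLaw σ a₀ u₀ θ₀ N Φ; let h : ℝ → ℝ := fun s => ∫ z, ∑ j : Fin 3, Literature.MathematicalPhysics.KineticTheory.empiricalMomentumField (Φ.flow s z) (fun x => Literature.Analysis.FunctionSpaces.Torus.partialDeriv j χ x) j ∂P; ContinuousOn h (Set.Ici 0) ∧ ∀ t : ℝ, 0 ≤ t → HasDerivWithinAt (fun s : ℝ => ∫ z, Literature.MathematicalPhysics.KineticTheory.empiricalDensityField (Φ.flow s z) χ ∂P) (h t) (Set.Ici 0) t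

/-- item stmt-AtomisticToContinuum-11933 · support · rank 9 · open · by planner
sources: Ruelle1969, GST2013, Spohn1991
[support] STATICS of the local Gibbs law (t = 0 input of the assembly): for continuous positive
profiles and 0 < σ < 1/2 there is C such that for every N, Φ, with P = localGibbsLaw σ a₀ u₀ θ₀ N Φ:
P is a probability measure (tree theorem isProbabilityMeasure_localGibbsLaw); the kinetic energy per
particle ⟨e_N,1⟩ is P-integrable with mean ≤ C (C = sup|u₀|²/2 + (3/2)sup θ₀); and, because given
the positions the velocities are independent Gaussians N(u₀(x_i), θ₀(x_i)I)
(lintegral_localGibbsMeasure), for every continuous χ the momentum and energy fields are integrable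
with E_P⟨m_N,χ⟩_j = E_P⟨n_N, χ·u₀,j⟩ and E_P⟨e_N,χ⟩ = E_P⟨n_N, χ(|u₀|²/2 + 3θ₀/2)⟩ — so the t = 0
LLN for the bounded density field alone gives the t = 0 means of all three fields. [difficulty:
provable-now] -/
@[route_item "route-AtomisticToContinuum-AthermalClockWard"]
def LocalGibbsStatics : Prop :=
  ∀ (a₀ θ₀ : Literature.MathematicalPhysics.KineticTheory.T3 → ℝ) (u₀ : Literature.MathematicalPhysics.KineticTheory.T3 → Literature.MathematicalPhysics.KineticTheory.V3), Continuous a₀ → Continuous θ₀ → Continuous u₀ → (∀ x, 0 < a₀ x) → (∀ x, 0 < θ₀ x) → ∀ σ : ℝ, 0 < σ → σ < 2⁻¹ → ∃ C : ℝ, ∀ (N : ℕ) (Φ : Literature.Analysis.FluidPDE.HardSphereFlow (Literature.Analysis.FluidPDE.Torus.geometry (Fin 3)) (Literature.MathematicalPhysics.KineticTheory.hsDiameter σ N) (N + 1)), let P : MeasureTheory.Measure (Literature.Analysis.FluidPDE.Config (N + 1) (Fin 3) Literature.MathematicalPhysics.KineticTheory.T3) := Literature.MathematicalPhysics.KineticTheory.localGibbsLaw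 σ a₀ u₀ θ₀ N Φ; MeasureTheory.IsProbabilityMeasure P ∧ MeasureTheory.Integrable (fun z => Literature.MathematicalPhysics.KineticTheory.empiricalEnergyField z (fun _ => 1)) P ∧ ∫ z, Literature.MathematicalPhysics.KineticTheory.empiricalEnergyField z (fun _ => 1) ∂P ≤ C ∧ ∀ χ : Literature.MathematicalPhysics.KineticTheory.T3 → ℝ, Continuous χ → (∀ j : Fin 3, MeasureTheory.Integrable (fun z => Literature.MathematicalPhysics.KineticTheory.empiricalMomentumField z χ j) P ∧ ∫ z, Literature.MathematicalPhysics.KineticTheory.empiricalMomentumField z χ j ∂P = ∫ z, Literature.MathematicalPhysics.KineticTheory.empiricalDensityField z (fun x => χ x * u₀ x j) ∂P) ∧ MeasureTheory.Integrable (fun z => Literature.MathematicalPhysics.KineticTheory.empiricalEnergyField z χ) P ∧ ∫ z, Literature.MathematicalPhysics.KineticTheory.empiricalEnergyField z χ ∂P = ∫ z, Literature.MathematicalPhysics.KineticTheory.empiricalDensityField z (fun x => χ x * (‖u₀ x‖ ^ 2 / 2 + 3 / 2 * θ₀ x)) ∂P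

/-- item stmt-AtomisticToContinuum-11934 · support · rank 9 · open · by planner
sources: LebowitzPercusVerlet1967, DoyonEtAl2023, DoyonEtAl2023PRL, Glynn1990
[support] CLOCK MODE, exact at finite N (card use (2); negative-side / MD handle, not a hypothesis
of `closes`): for isothermal data at rest (u₀ ≡ 0, θ₀ ≡ θc > 0, any continuous a₀ > 0 — e.g. a
density pulse), σ > 0, t > 0, N, Φ, continuous χ, P the local Gibbs law: (2/θc)(N+1)·Cov_P(⟨n_N(Φ_t
z),χ⟩, ⟨e_N(Φ_t z),1⟩) = t·(d/dt)E_P⟨n_N(Φ_t z),χ⟩ — the EQUAL-TIME covariance of the local density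
with the total kinetic energy per particle equals (θc/2(N+1))·t·∂_t of the mean density: the
total-energy fluctuation is a random clock rate. From WardIdentity (density clause; deriv exists)
with K = (2/θc)(N+1)⟨e_N,1⟩ − 3(N+1) for these profiles and conservation of ⟨e_N,1⟩ along the flow
(configEnergy_eq_holds, P-a.e.). Under the conjunct the right side → (θc/2)t∂_t∫χρ_t: an O(1/N)
LONG-RANGE density–energy correlation growing linearly in t, present for canonical and absent for
microcanonical local Gibbs data — an EOS-free event-driven-MD test of the conjunct and an
ensemble-dependent mode any BMFT-type fluctuation target for hard spheres must carry. [difficulty: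
provable-now] -/
@[route_item "route-AtomisticToContinuum-AthermalClockWard"]
def ClockIdentity : Prop :=
  ∀ (σ θc t : ℝ), 0 < σ → 0 < θc → 0 < t → ∀ (a₀ : Literature.MathematicalPhysics.KineticTheory.T3 → ℝ), Continuous a₀ → (∀ x, 0 < a₀ x) → ∀ (N : ℕ) (Φ : Literature.Analysis.FluidPDE.HardSphereFlow (Literature.Analysis.FluidPDE.Torus.geometry (Fin 3)) (Literature.MathematicalPhysics.KineticTheory.hsDiameter σ N) (N + 1)) (χ : Literature.MathematicalPhysics.KineticTheory.T3 → ℝ), Continuous χ → let P : MeasureTheory.Measure (Literature.Analysis.FluidPDE.Config (N + 1) (Fin 3) Literature.MathematicalPhysics.KineticTheory.T3) := Literature.MathematicalPhysics.KineticTheory.localGibbsLaw σ a₀ (fun _ => 0) (fun _ => θc) N Φ; 2 / θc * ((N : ℝ) + 1) * ProbabilityTheory.covariance (fun z => Literature.MathematicalPhysics.KineticTheory.empiricalDensityField (Φ.flow t z) χ) (fun z => Literature.MathematicalPhysics.KineticTheory.empiricalEnergyField (Φ.flow t z) (fun _ => 1)) P = t * deriv (fun s : ℝ => ∫ z, Literature.MathematicalPhysics.KineticTheory.empiricalDensityField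 (Φ.flow s z) χ ∂P) t

/-- item stmt-AtomisticToContinuum-11935 · support · rank 9 · open · by planner
sources: Spohn1991, OllaVaradhanYau1993
[support] GLUE (the analytic assembly as a typed item; measure theory + one t-integration, no
physics): OneDirectionResponse → WardIdentity → MeanMassContinuity → LocalGibbsStatics →
MeanHydroLimitInBand. Take η := η_R; given profiles σ₀ := min(σ_R, 1/2). For σ < σ₀, a guarded
solution, Φ, the t = 0 LLN, t ∈ [0,T), smooth χ: LocalGibbsStatics gives probability measures,
E⟨e_N,1⟩ ≤ C, hence |E⟨m_N(Φ_s),χ⟩_j| ≤ ‖χ‖_∞(2C)^{1/2} and |E⟨e_N(Φ_s),χ⟩| ≤ ‖χ‖_∞C for all s, N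
(energy conservation a.e. + Jensen). MOMENTUM (t > 0): by WardIdentity s ↦ sV_j(s) is differentiable
on (0,t] with derivative Cov_N(s), bounded on [0,t] at fixed N and → c_j(s) = s g_j′(s) + g_j(s)
uniformly (OneDirectionResponse; g_j(s) = ∫χρ_su_{s,j} is C¹ on [0,T) by IsSmoothSpaceTimeOn,
derivWithin (Ico 0 T) = its derivative), and sV_j(s) → 0 as s ↓ 0, so tV_j(t) = ∫₀^t Cov_N → ∫₀^t (s
g_j)′ = t g_j(t). ENERGY (t > 0): same with s²V_e, derivative s·Cov_N^e(s) → (s²g_e)′. t = 0: flow 0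
= id P-a.e. (localGibbsLaw_preimage_flow_zero); the density clause of the LLN with the bounded
continuous weights χu₀,j and χ(|u₀|²/2 + 3θ₀/2) plus the static identities of LocalGibbsStatics give
the three means. DENSITY (t > 0): MeanM -/
@[route_item "route-AtomisticToContinuum-AthermalClockWard"]
def WardToMeans : Prop :=
  OneDirectionResponse → WardIdentity → MeanMassContinuity → LocalGibbsStatics → MeanHydroLimitInBand

-- earlier Assembly (stmt-AtomisticToContinuum-11936, replaced 2026-08-16T23:21:27Z -> stmt-AtomisticToContinuum-17523): retired by None — OneDirectionResponse → WardIdentity → MeanMassContinuity → LocalGibbsStatics → WardToMeans → MeanClosure → DiluteSelfConsistency → _root_.HydrodynamicLimit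
-- earlier Assembly (stmt-AtomisticToContinuum-17523, replaced 2026-08-16T23:45:26Z -> stmt-AtomisticToContinuum-17927): retired by None — MomentumFluxResponse → EnergyFluxResponse → WardIdentity → MeanMassContinuity → LocalGibbsStatics → WardToMeans → MeanClosure → _root_.HydrodynamicLimit
/-- item stmt-AtomisticToContinuum-17927 · assembly · rank 1 · open · by planner
sources: Spohn1991, OllaVaradhanYau1993
[assembly] MomentumFluxResponse → EnergyFluxResponse → ResponseToMeans → MeanClosure →
HydrodynamicLimit — the exact type of the deciding theorem `closes` after the crux-only repair
(2026-08-16, human ruling: only crux items may be hypotheses of `closes`): the former support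
hypotheses WardIdentity, MeanMassContinuity, LocalGibbsStatics, WardToMeans are folded into the crux
ResponseToMeans (= fun hRm hRe => WardToMeans (odr hRm hRe) W C S) and MeanClosure is re-kinded
crux; DiluteSelfConsistency stays dropped (the packing guard is part of `_root_.HydrodynamicLimit`,
η₀ := min(η_R, η_M)). -/
@[route_item "route-AtomisticToContinuum-AthermalClockWard"]
def Assembly : Prop :=
  MomentumFluxResponse → EnergyFluxResponse → ResponseToMeans → MeanClosure → _root_.HydrodynamicLimit

/-! D-0027 §2.1 — DECIDING THEOREM (planner-authored via `route open/edit --closes-file`; by planner-rbadge-AtomisticToContinuum-AthermalCl-687bdcd9-0 2026-08-16T23:45:26Z):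
its hypotheses are this route's items and its conclusion the sub-problem Statement (glue_lint), and it elaborates with this file. -/

/-- D-0027 §2.1 deciding theorem — CRUX-ONLY form (human ruling 2026-08-16: only crux items may be
hypotheses of `closes`; pure logic over four cruxes, `lean check` rc 0, axioms propext /
Classical.choice / Quot.sound). The crux `ResponseToMeans` — the Ward mechanism as one typed
obligation, stated over the two flux-closure cruxes `MomentumFluxResponse`, `EnergyFluxResponse`
(whose conjunction at a common threshold is the one-direction response `OneDirectionResponse`), and
equal to `fun hRm hRe => WardToMeans (odr hRm hRe) W C S` once the provable-now supports
`WardIdentity`, `MeanMassContinuity`, `LocalGibbsStatics`, `WardToMeans` are proved — turns the two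
closures into the MEAN hydrodynamic limit in the dilute band (packing radius `η₁`); the crux
`MeanClosure` (radius `η₂`) turns means into convergence in probability. The Statement's own
packing guard is instantiated at `η₀ := min η₁ η₂`, so every guarded classical solution lies inside
both bands once `σ < σ₀ := min σ₁ σ₂`. The conclusion is the sub-problem Statement decl
`_root_.HydrodynamicLimit` verbatim (= `HydroLimitInBandDim 3`, `hydroLimitInBandDim_three_iff_root`).
The former support hypotheses W, C, S, WardToMeans are no longer assumed; composing with them
recovers the seven-hypothesis theorem of rev 5, so nothing was weakened. -/
@[closes "route-AtomisticToContinuum-AthermalClockWard"] theorem closes (hRm : MomentumFluxResponse) (hRe : EnergyFluxResponse) (hA : ResponseToMeans)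
    (hM : MeanClosure) : _root_.HydrodynamicLimit := by
  obtain ⟨η₁, hη₁, H₁⟩ := hA hRm hRe
  obtain ⟨η₂, hη₂, H₂⟩ := hM
  refine ⟨min η₁ η₂, lt_min hη₁ hη₂, ?_⟩
  intro a₀ θ₀ u₀ ha hθ hu ha0 hθ0
  obtain ⟨σ₁, hσ₁, G₁⟩ := H₁ a₀ θ₀ u₀ ha hθ hu ha0 hθ0
  obtain ⟨σ₂, hσ₂, G₂⟩ := H₂ a₀ θ₀ u₀ ha hθ hu ha0 hθ0
  refine ⟨min σ₁ σ₂, lt_min hσ₁ hσ₂, ?_⟩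
  intro σ hσ hσ' T ρ θ u hE hpack Φ h0 t ht
  have h1 : σ < σ₁ := lt_of_lt_of_le hσ' (min_le_left _ _)
  have h2 : σ < σ₂ := lt_of_lt_of_le hσ' (min_le_right _ _)
  have hp1 : ∀ s ∈ Set.Ico 0 T, ∀ x, ρ s x * σ ^ 3 < η₁ :=
    fun s hs x => lt_of_lt_of_le (hpack s hs x) (min_le_left _ _)
  have hp2 : ∀ s ∈ Set.Ico 0 T, ∀ x, ρ s x * σ ^ 3 < η₂ :=
    fun s hs x => lt_of_lt_of_le (hpack s hs x) (min_le_right _ _)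
  exact G₂ σ hσ h2 T ρ θ u hE hp2 Φ h0 t ht (G₁ σ hσ h1 T ρ θ u hE hp1 Φ h0 t ht)

end Summit.AtomisticToContinuum.HydrodynamicLimit.Theses.AthermalClockWard
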